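import Summits.AnomalousDissipation.AnomalousDissipation.Theorems.MarginalStabilityChainStrainedLayerLawClockEnergyRelaminarisationToolsA
import HarnessLib

/-!
# Crux `MarginalStabilityChain.StrainedLayerLaw` (stmt-AnomalousDissipation-3007), line `FirstLemmasR2K4`
# (log-enstrophy clock + Nash roundness): energy relaminarisation of the tailed class — tools B

Support file (`--supports stmt-AnomalousDissipation-3007`; registered sub-goal `energyRelam_identity`, the second
tool file of the registered sub-goal `energy_relaminarisation` of line `FirstLemmasR2K4`, lead c7), everything proved:
THE PERTURBATION ENERGY IDENTITY AT A FIXED TIME. For a classical solution `(u, v, p)` of the stretched layer system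
(`γ = ΔU = 1`, period `L`, viscosity `ν > 0`) and a time `t > 0` with shear tails `SliceTails C k (u t) (v t)` and time
derivatives `≤ Ce^{−k|y|}`, the perturbation `(a, b) = (u − U_B, v)` of the laminar Burgers layer
`U_B = burgersLayerProfile 1 ν 1` satisfies, over the period strip `(0, L] × ℝ`,

  `∫∫ (a ∂ₜu + b ∂ₜv) = −∫∫ a b U_B′ − ½ ∫∫ (a² + b²) + ∫∫ b² − ν ∫∫ (|∇a|² + |∇b|²)`,

all strip integrands being integrable. Proof = Majda–Bertozzi's basic energy identity (2002, §3.1.1, and the Remark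
after Prop. 3.4) for the EXACT perturbation equations
`∂ₜa + u∂ₓa + (v − y)∂_ya + bU_B′ = −∂ₓp + νΔa`, `∂ₜb + u∂ₓb + (v − y)∂_yb − b = −∂_yp + νΔb` (the laminar equation
`νU_B″ + yU_B′ = 0` removes the background terms pointwise): pair with `(a, b)`; transport
`−∫∫ (u∂ₓφ + (v − y)∂_yφ) = −∫∫ φ`, `φ = ½(a² + b²)` (`integral_strip_transport`, `div (u, v − y) = −1`); strain
`−∫∫ abU_B′`; stretching `+∫∫ b²`; pressure `0` (`integral_strip_pressure_eq_zero`, `energyRelam_pressure`);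
viscosity `−ν∫∫ |∇(a, b)|²` exactly (`stub_strainWorkIdentity_viscous`). This is the identity of the energy method of
Serrin (1959) / Joseph (1976) written for the strained shear layer; laminar sanity check `a = b = 0 ⇒` both sides `0`.

References: A. J. Majda, A. L. Bertozzi, *Vorticity and Incompressible Flow*, CUP 2002, §3.1.1, eq. (3.5), and §3.1.3
Remark after Prop. 3.4; D. D. Joseph, *Stability of Fluid Motions I*, Springer 1976, §2–§4; J. Serrin, Arch. Rational
Mech. Anal. 3 (1959) 1–13.
-/

-- `Summit.<Summit>.<Problem>` is the tree's mandated summit-side namespace (CONVENTIONS §2); for this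
-- single-conjunct summit the two coincide, so the duplicate is deliberate.
set_option linter.dupNamespace false

noncomputable section

open scoped Topology ENNReal
open Filter Set Function MeasureTheory

namespace Summit.AnomalousDissipation.AnomalousDissipation.Theorems.StrainedLayerLaw.LogEnstrophyClock

open Literature.Analysis.FluidPDE Literature.Analysis.FluidPDE.StretchedLayer
open Summit.AnomalousDissipation.AnomalousDissipation.Theses.MarginalStabilityChain
open Summit.AnomalousDissipation.AnomalousDissipation.Theorems.StrainedLayerLaw.StrainWorkSumRule

/-! ## The perturbation energy identity at a fixed time -/

/-- **The perturbation energy identity of the strained shear layer at a fixed time** (registered sub-goal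
`energyRelam_identity`). For a classical solution `(u, v, p)` of the stretched two-dimensional Navier–Stokes layer
system (`γ = ΔU = 1`, period `L > 0`, viscosity `ν > 0`) on `(0, ∞)` and a time `t > 0` at which the slice has shear
tails `SliceTails C k (u t) (v t)` (`k > 0`) and time derivatives `≤ Ce^{−k|y|}`, the perturbation
`(a, b) = (u − U_B, v)` of the Burgers layer `U_B = burgersLayerProfile 1 ν 1` has integrable energy, strain, gradient
and power densities on the period strip `(0, L] × ℝ` and

  `∫∫ (a∂ₜu + b∂ₜv) = −∫∫ abU_B′ − ½∫∫ (a² + b²) + ∫∫ b² − ν∫∫ ((∂ₓu)² + (∂_yu − U_B′)² + (∂ₓv)² + (∂_yv)²)`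

(Majda–Bertozzi 2002, §3.1.1 basic energy identity for the exact perturbation equations
`∂ₜa + u∂ₓa + (v − y)∂_ya + bU_B′ = −∂ₓp + νΔa`, `∂ₜb + u∂ₓb + (v − y)∂_yb − b = −∂_yp + νΔb`, where
`νU_B″ + yU_B′ = 0` removed the background: transport `−∫∫ ½(a² + b²)` since `div (u, v − y) = −1`, strain
`−∫∫ abU_B′`, stretching `+∫∫ b²`, pressure `0`, viscosity `−ν∫∫|∇(a,b)|²`; the energy method of Serrin / Joseph for
the strained layer). [folklore] -/
theorem energyRelam_identity : ∀ (ν L t C k : ℝ) (u v p : ℝ → ℝ → ℝ → ℝ), 0 < ν → 0 < L → 0 < t → 0 < k →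
    IsStretchedLayerNSSolutionOn (Ioi 0) ν 1 1 L u v p → SliceTails C k (u t) (v t) →
    (∀ x y, |deriv (fun s => u s x y) t| + |deriv (fun s => v s x y) t| ≤ C * Real.exp (-k * |y|)) →
      IntegrableOn (fun q : ℝ × ℝ => (u t q.1 q.2 - burgersLayerProfile 1 ν 1 q.2) ^ 2 + v t q.1 q.2 ^ 2)
        (Ioc 0 L ×ˢ univ) ∧
      IntegrableOn (fun q : ℝ × ℝ => v t q.1 q.2 ^ 2) (Ioc 0 L ×ˢ univ) ∧
      IntegrableOn (fun q : ℝ × ℝ => dX (v t) q.1 q.2 ^ 2) (Ioc 0 L ×ˢ univ) ∧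
      IntegrableOn (fun q : ℝ × ℝ => (u t q.1 q.2 - burgersLayerProfile 1 ν 1 q.2) * v t q.1 q.2 *
        burgersLayerProfileD 1 ν 1 q.2) (Ioc 0 L ×ˢ univ) ∧
      IntegrableOn (fun q : ℝ × ℝ => dX (u t) q.1 q.2 ^ 2 + (dY (u t) q.1 q.2 - burgersLayerProfileD 1 ν 1 q.2) ^ 2 +
        dX (v t) q.1 q.2 ^ 2 + dY (v t) q.1 q.2 ^ 2) (Ioc 0 L ×ˢ univ) ∧
      IntegrableOn (fun q : ℝ × ℝ => (u t q.1 q.2 - burgersLayerProfile 1 ν 1 q.2) * deriv (fun s => u s q.1 q.2) t +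
        v t q.1 q.2 * deriv (fun s => v s q.1 q.2) t) (Ioc 0 L ×ˢ univ) ∧
      ∫ q in Ioc 0 L ×ˢ univ, ((u t q.1 q.2 - burgersLayerProfile 1 ν 1 q.2) * deriv (fun s => u s q.1 q.2) t +
          v t q.1 q.2 * deriv (fun s => v s q.1 q.2) t) =
        -(∫ q in Ioc 0 L ×ˢ univ, (u t q.1 q.2 - burgersLayerProfile 1 ν 1 q.2) * v t q.1 q.2 *
            burgersLayerProfileD 1 ν 1 q.2)
        - (1 / 2) * (∫ q in Ioc 0 L ×ˢ univ, ((u t q.1 q.2 - burgersLayerProfile 1 ν 1 q.2) ^ 2 + v t q.1 q.2 ^ 2))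
        + (∫ q in Ioc 0 L ×ˢ univ, v t q.1 q.2 ^ 2)
        - ν * ∫ q in Ioc 0 L ×ˢ univ, (dX (u t) q.1 q.2 ^ 2 + (dY (u t) q.1 q.2 - burgersLayerProfileD 1 ν 1 q.2) ^ 2 +
            dX (v t) q.1 q.2 ^ 2 + dY (v t) q.1 q.2 ^ 2) := by
  intro ν L t C k u v p hν hL ht hk h hST hT
  have ht' : t ∈ Ioi (0:ℝ) := ht
  obtain ⟨-, -, hD0, -, hode, -⟩ := energyRelam_profile hν
  have hu2 := h.contDiff_u ht'
  have hv2 := h.contDiff_v ht'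
  have hp1 := h.contDiff_p ht'
  obtain ⟨k', D, hk', -, hCD, hD1, ha2, hXa, hYa, hLa, hek, ha0, hay0, hla0, hUBD⟩ :=
    energyRelam_perturbation hν hk hu2 hST (h.tendsto_u_atTop t ht') (h.tendsto_u_atBot t ht')
  obtain ⟨Q, hQ0, hQ⟩ := energyRelam_pressure ν L t C k u v p hL ht hk h hST hT
  set UB := burgersLayerProfile 1 ν 1 with hUB_def
  set UB' := burgersLayerProfileD 1 ν 1 with hUB'_def
  set UB'' := burgersLayerProfileDD 1 ν 1 with hUB''_def
  set a : ℝ → ℝ → ℝ := fun x y => u t x y - UB y with ha_def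
  -- constants and weights
  have hC : 0 ≤ C := hST.nonneg
  have hD : 0 ≤ D := by linarith
  have he1 : ∀ y, Real.exp (-k' * |y|) ≤ 1 := exp_neg_mul_abs_le_one hk'
  have he0 : ∀ y, 0 < Real.exp (-k' * |y|) := fun y => Real.exp_pos _
  have up : ∀ {z y : ℝ}, |z| ≤ C * Real.exp (-k * |y|) → |z| ≤ D * Real.exp (-k' * |y|) := fun {z y} hz =>
    hz.trans ((mul_le_mul_of_nonneg_left (hek y) hC).trans (mul_le_mul_of_nonneg_right (by linarith) (he0 y).le))
  have dn : ∀ {z y : ℝ}, |z| ≤ D * Real.exp (-k' * |y|) → |z| ≤ D := fun hz =>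
    hz.trans (mul_le_of_le_one_right hD (he1 _))
  -- atomic bounds at time `t`
  have ha0' : ∀ x y, |a x y| ≤ D * Real.exp (-k' * |y|) := ha0
  have haD : ∀ x y, |a x y| ≤ D := fun x y => dn (ha0' x y)
  have hb0 : ∀ x y, |v t x y| ≤ D * Real.exp (-k' * |y|) := fun x y => up (hST.abs_v_le x y)
  have hbD : ∀ x y, |v t x y| ≤ D := fun x y => dn (hb0 x y)
  have hax : ∀ x y, |dX a x y| ≤ D * Real.exp (-k' * |y|) := fun x y => by
    rw [hXa]; exact up (hST.abs_dX_u_le x y)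
  have hay : ∀ x y, |dY a x y| ≤ D * Real.exp (-k' * |y|) := fun x y => by rw [hYa]; exact hay0 x y
  have hbx : ∀ x y, |dX (v t) x y| ≤ D * Real.exp (-k' * |y|) := fun x y => up (hST.abs_dX_v_le x y)
  have hby : ∀ x y, |dY (v t) x y| ≤ D * Real.exp (-k' * |y|) := fun x y => up (hST.abs_dY_v_le x y)
  have hlapa : ∀ x y, |lap a x y| ≤ D * Real.exp (-k' * |y|) := fun x y => by rw [hLa]; exact hla0 x y
  have hlapb : ∀ x y, |lap (v t) x y| ≤ D * Real.exp (-k' * |y|) := fun x y => up (hST.abs_lap_v_le x y)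
  have hux : ∀ x y, |dX (u t) x y| ≤ D * Real.exp (-k' * |y|) := fun x y => up (hST.abs_dX_u_le x y)
  have hu : ∀ x y, |u t x y| ≤ D := fun x y => (hST.abs_u_le hk x y).trans (by linarith)
  have huxD : ∀ x y, |dX (u t) x y| ≤ D := fun x y => dn (hux x y)
  have hvy1 : ∀ x y, |v t x y - 1 * y| ≤ D * (1 + |y|) := fun x y => by
    have h1 := abs_sub_mul_le_linear (γ := 1) y hC (hST.abs_v_le_const hk x y)
    rw [abs_one] at h1
    exact h1.trans (mul_le_mul_of_nonneg_right hCD (by positivity))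
  have hvy1' : ∀ x y, |v t x y - 1 * y| ≤ D * (1 + |y|) ^ 2 := fun x y =>
    abs_le_mul_one_add_abs_sq_of_abs_le_linear y hD (hvy1 x y)
  have hvyγ : ∀ x y, |dY (v t) x y - 1| ≤ 2 * D := fun x y =>
    (abs_sub _ _).trans (by rw [abs_one]; linarith [dn (hby x y)])
  have hpx : ∀ x y, |dX (p t) x y| ≤ Q * (1 + |y|) ^ 2 := fun x y =>
    (hQ x y).2.1.trans (mul_le_mul_of_nonneg_left
      (mul_le_of_le_one_right (by positivity) (exp_neg_mul_abs_le_one hk y)) hQ0)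
  -- regularity atoms
  have hu1 : ContDiff ℝ 1 (fun q : ℝ × ℝ => u t q.1 q.2) := hu2.of_le one_le_two
  have hv1 : ContDiff ℝ 1 (fun q : ℝ × ℝ => v t q.1 q.2) := hv2.of_le one_le_two
  have ha1 : ContDiff ℝ 1 (fun q : ℝ × ℝ => a q.1 q.2) := ha2.of_le one_le_two
  have ca : Continuous (fun q : ℝ × ℝ => a q.1 q.2) := ha2.continuous
  have cb : Continuous (fun q : ℝ × ℝ => v t q.1 q.2) := hv2.continuous
  have cu : Continuous (fun q : ℝ × ℝ => u t q.1 q.2) := hu2.continuous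
  have cax := continuous_dX ha1
  have cay := continuous_dY ha1
  have cbx := continuous_dX hv1
  have cby := continuous_dY hv1
  have cux := continuous_dX hu1
  have cuy := continuous_dY hu1
  have cp : Continuous (fun q : ℝ × ℝ => p t q.1 q.2) := hp1.continuous
  have cpx := continuous_dX hp1
  have cpy := continuous_dY hp1
  have cut : Continuous (fun q : ℝ × ℝ => deriv (fun s => u s q.1 q.2) t) :=
    continuous_deriv_time isOpen_Ioi h.contDiffOn_u ht'
  have cvt : Continuous (fun q : ℝ × ℝ => deriv (fun s => v s q.1 q.2) t) :=
    continuous_deriv_time isOpen_Ioi h.contDiffOn_v ht'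
  have cvy1 : Continuous (fun q : ℝ × ℝ => v t q.1 q.2 - 1 * q.2) :=
    cb.sub (continuous_const.mul continuous_snd)
  have clapa : Continuous (fun q : ℝ × ℝ => lap a q.1 q.2) := by
    simp only [lap_apply]; exact (continuous_dXdX ha2).add (continuous_dYdY ha2)
  have clapb : Continuous (fun q : ℝ × ℝ => lap (v t) q.1 q.2) := by
    simp only [lap_apply]; exact (continuous_dXdX hv2).add (continuous_dYdY hv2)
  have cUB' : Continuous (fun q : ℝ × ℝ => UB' q.2) := by
    have hc : Continuous UB' := by rw [hUB'_def]; unfold burgersLayerProfileD; fun_prop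
    exact hc.comp continuous_snd
  -- the time-derivative tails
  have hut : ∀ x y, |deriv (fun s => u s x y) t| ≤ D * Real.exp (-k' * |y|) := fun x y =>
    up (by linarith [hT x y, abs_nonneg (deriv (fun s => v s x y) t)])
  have hvt : ∀ x y, |deriv (fun s => v s x y) t| ≤ D * Real.exp (-k' * |y|) := fun x y =>
    up (by linarith [hT x y, abs_nonneg (deriv (fun s => u s x y) t)])
  -- the momentum equations and the slice derivatives of `u` through `a`
  have hmx : ∀ x y, deriv (fun s => u s x y) t + u t x y * dX (u t) x y +
      (v t x y - 1 * y) * dY (u t) x y = -dX (p t) x y + ν * lap (u t) x y := fun x y => by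
    have e := h.momentum_x t ht' x y
    rwa [dT_of_isOpen isOpen_Ioi u ht'] at e
  have hmy : ∀ x y, deriv (fun s => v s x y) t + u t x y * dX (v t) x y +
      (v t x y - 1 * y) * dY (v t) x y - 1 * v t x y = -dY (p t) x y + ν * lap (v t) x y := fun x y => by
    have e := h.momentum_y t ht' x y
    rwa [dT_of_isOpen isOpen_Ioi v ht'] at e
  have hXu : ∀ x y, dX (u t) x y = dX a x y := fun x y => (hXa x y).symm
  have hYu : ∀ x y, dY (u t) x y = dY a x y + UB' y := fun x y => by rw [hYa]; ring
  have hLu : ∀ x y, lap (u t) x y = lap a x y + UB'' y := fun x y => by rw [hLa]; ring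
  -- the energy density `φ = ½(a² + b²)`
  set φ : ℝ → ℝ → ℝ := fun x y => (a x y * a x y + v t x y * v t x y) / 2 with hφ_def
  have hφ1 : ContDiff ℝ 1 (fun q : ℝ × ℝ => φ q.1 q.2) := contDiff_half_sq_add_sq ha1 hv1
  have cφ : Continuous (fun q : ℝ × ℝ => φ q.1 q.2) := hφ1.continuous
  have cφx := continuous_dX hφ1
  have cφy := continuous_dY hφ1
  have hφx : ∀ x y, dX φ x y = a x y * dX a x y + v t x y * dX (v t) x y := fun x y =>
    dX_half_sq_add_sq (hasDerivAt_dX_of_contDiff ha2 two_ne_zero x y).differentiableAt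
      (hasDerivAt_dX_of_contDiff hv2 two_ne_zero x y).differentiableAt
  have hφy : ∀ x y, dY φ x y = a x y * dY a x y + v t x y * dY (v t) x y := fun x y =>
    dY_half_sq_add_sq (hasDerivAt_dY_of_contDiff ha2 two_ne_zero x y).differentiableAt
      (hasDerivAt_dY_of_contDiff hv2 two_ne_zero x y).differentiableAt
  have hpera : ∀ x y, a (x + L) y = a x y := fun x y => by
    simp only [ha_def, h.periodic_u t ht']
  have hperφ : ∀ x y, φ (x + L) y = φ x y := fun x y => by
    simp only [hφ_def, hpera, h.periodic_v t ht']
  have hdiva : ∀ x y, dX a x y + dY (v t) x y = 0 := fun x y => by rw [hXa]; exact h.divFree t ht' x y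
  -- products of bounded and decaying factors
  have pm : ∀ {f₁ f₂ M₁ M₂ : ℝ} {y : ℝ}, |f₁| ≤ M₁ → |f₂| ≤ M₂ * Real.exp (-k' * |y|) →
      |f₁ * f₂| ≤ M₁ * M₂ * Real.exp (-k' * |y|) := fun h₁ h₂ => by
    rw [abs_mul, mul_assoc]; exact mul_le_mul h₁ h₂ (abs_nonneg _) ((abs_nonneg _).trans h₁)
  have hφ0 : ∀ x y, |φ x y| ≤ D * D * Real.exp (-k' * |y|) := fun x y => by
    have h1 := pm (haD x y) (ha0' x y)
    have h2 := pm (hbD x y) (hb0 x y)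
    simp only [hφ_def, abs_div, abs_two]
    have h3 := abs_add_le (a x y * a x y) (v t x y * v t x y)
    nlinarith [he0 y]
  have hφx0 : ∀ x y, |dX φ x y| ≤ 2 * (D * D) * Real.exp (-k' * |y|) := fun x y => by
    rw [hφx]
    have h1 := pm (haD x y) (hax x y)
    have h2 := pm (hbD x y) (hbx x y)
    exact (abs_add_le _ _).trans (by linarith)
  have hφy0 : ∀ x y, |dY φ x y| ≤ 2 * (D * D) * Real.exp (-k' * |y|) := fun x y => by
    rw [hφy]
    have h1 := pm (haD x y) (hay x y)
    have h2 := pm (hbD x y) (hby x y)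
    exact (abs_add_le _ _).trans (by linarith)
  -- integrability on the strip: transport
  have iT1 : IntegrableOn (fun q : ℝ × ℝ => u t q.1 q.2 * dX φ q.1 q.2) (Ioc 0 L ×ˢ univ) :=
    integrableOn_strip_of_abs_le_exp (cu.mul cφx) (by positivity : 0 ≤ D * (2 * (D * D))) hk'
      fun x _ y => pm (hu x y) (hφx0 x y)
  have iT2 : IntegrableOn (fun q : ℝ × ℝ => dX (u t) q.1 q.2 * φ q.1 q.2) (Ioc 0 L ×ˢ univ) :=
    integrableOn_strip_of_abs_le_exp (cux.mul cφ) (by positivity : 0 ≤ D * (D * D)) hk'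
      fun x _ y => pm (huxD x y) (hφ0 x y)
  have iT3 : IntegrableOn (fun q : ℝ × ℝ => (v t q.1 q.2 - 1 * q.2) * dY φ q.1 q.2) (Ioc 0 L ×ˢ univ) :=
    integrableOn_strip_of_abs_le_sq_exp (cvy1.mul cφy) hk' fun x _ y =>
      abs_mul_le_weight' y (by positivity) (hvy1' x y) (hφy0 x y)
  have iT4 : IntegrableOn (fun q : ℝ × ℝ => (dY (v t) q.1 q.2 - 1) * φ q.1 q.2) (Ioc 0 L ×ˢ univ) :=
    integrableOn_strip_of_abs_le_exp ((cby.sub continuous_const).mul cφ)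
      (by positivity : 0 ≤ 2 * D * (D * D)) hk' fun x _ y => pm (hvyγ x y) (hφ0 x y)
  have iT5 : IntegrableOn (fun q : ℝ × ℝ => (v t q.1 q.2 - 1 * q.2) * φ q.1 q.2) (Ioc 0 L ×ˢ univ) :=
    integrableOn_strip_of_abs_le_sq_exp (cvy1.mul cφ) hk' fun x _ y =>
      abs_mul_le_weight' y (by positivity) (hvy1' x y) (hφ0 x y)
  -- integrability on the strip: pressure
  have iP1 : IntegrableOn (fun q : ℝ × ℝ => a q.1 q.2 * dX (p t) q.1 q.2) (Ioc 0 L ×ˢ univ) :=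
    integrableOn_strip_of_abs_le_sq_exp (ca.mul cpx) hk' fun x _ y => abs_mul_le_weight y hD (ha0' x y) (hpx x y)
  have iP2 : IntegrableOn (fun q : ℝ × ℝ => dX a q.1 q.2 * p t q.1 q.2) (Ioc 0 L ×ˢ univ) :=
    integrableOn_strip_of_abs_le_sq_exp (cax.mul cp) hk' fun x _ y => abs_mul_le_weight y hD (hax x y) (hQ x y).1
  have iP3 : IntegrableOn (fun q : ℝ × ℝ => v t q.1 q.2 * dY (p t) q.1 q.2) (Ioc 0 L ×ˢ univ) :=
    integrableOn_strip_of_abs_le_sq_exp (cb.mul cpy) hk' fun x _ y =>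
      abs_mul_le_weight y hD (hb0 x y) (abs_le_mul_one_add_abs_sq_of_abs_le_linear y hQ0 (hQ x y).2.2)
  have iP4 : IntegrableOn (fun q : ℝ × ℝ => dY (v t) q.1 q.2 * p t q.1 q.2) (Ioc 0 L ×ˢ univ) :=
    integrableOn_strip_of_abs_le_sq_exp (cby.mul cp) hk' fun x _ y => abs_mul_le_weight y hD (hby x y) (hQ x y).1
  have iP5 : IntegrableOn (fun q : ℝ × ℝ => v t q.1 q.2 * p t q.1 q.2) (Ioc 0 L ×ˢ univ) :=
    integrableOn_strip_of_abs_le_sq_exp (cb.mul cp) hk' fun x _ y => abs_mul_le_weight y hD (hb0 x y) (hQ x y).1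
  -- integrability on the strip: strain, energies, power, gradients, viscosity
  have iS : IntegrableOn (fun q : ℝ × ℝ => a q.1 q.2 * v t q.1 q.2 * UB' q.2) (Ioc 0 L ×ˢ univ) :=
    integrableOn_strip_of_abs_le_exp ((ca.mul cb).mul cUB') (by positivity : 0 ≤ D * D * D) hk' fun x _ y => by
      have h1 := pm (haD x y) (hb0 x y)
      rw [abs_mul]
      calc |a x y * v t x y| * |UB' y| ≤ D * D * Real.exp (-k' * |y|) * D :=
            mul_le_mul h1 (hUBD y) (abs_nonneg _) (by positivity)
        _ = D * D * D * Real.exp (-k' * |y|) := by ring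
  have iE : IntegrableOn (fun q : ℝ × ℝ => a q.1 q.2 ^ 2 + v t q.1 q.2 ^ 2) (Ioc 0 L ×ˢ univ) :=
    integrableOn_strip_of_abs_le_exp ((ca.pow 2).add (cb.pow 2)) (by positivity : 0 ≤ 2 * (D * D)) hk'
      fun x _ y => by
        have h1 := pm (haD x y) (ha0' x y)
        have h2 := pm (hbD x y) (hb0 x y)
        rw [abs_of_nonneg (by positivity), sq, sq]
        linarith [le_abs_self (a x y * a x y), le_abs_self (v t x y * v t x y)]
  have ibb : IntegrableOn (fun q : ℝ × ℝ => v t q.1 q.2 ^ 2) (Ioc 0 L ×ˢ univ) :=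
    integrableOn_strip_of_abs_le_exp (cb.pow 2) (by positivity : 0 ≤ D * D) hk' fun x _ y => by
      have h2 := pm (hbD x y) (hb0 x y)
      rw [abs_of_nonneg (by positivity), sq]
      linarith [le_abs_self (v t x y * v t x y)]
  have ibx : IntegrableOn (fun q : ℝ × ℝ => dX (v t) q.1 q.2 ^ 2) (Ioc 0 L ×ˢ univ) :=
    integrableOn_strip_of_abs_le_exp (cbx.pow 2) (by positivity : 0 ≤ D * D) hk' fun x _ y => by
      have h2 := pm (dn (hbx x y)) (hbx x y)
      rw [abs_of_nonneg (by positivity), sq]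
      linarith [le_abs_self (dX (v t) x y * dX (v t) x y)]
  have iL : IntegrableOn (fun q : ℝ × ℝ => a q.1 q.2 * deriv (fun s => u s q.1 q.2) t +
      v t q.1 q.2 * deriv (fun s => v s q.1 q.2) t) (Ioc 0 L ×ˢ univ) :=
    integrableOn_strip_of_abs_le_exp ((ca.mul cut).add (cb.mul cvt)) (by positivity : 0 ≤ 2 * (D * D)) hk'
      fun x _ y => by
        have h1 := pm (haD x y) (hut x y)
        have h2 := pm (hbD x y) (hvt x y)
        exact (abs_add_le _ _).trans (by linarith)
  have iG : IntegrableOn (fun q : ℝ × ℝ => dX (u t) q.1 q.2 ^ 2 + (dY (u t) q.1 q.2 - UB' q.2) ^ 2 +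
      dX (v t) q.1 q.2 ^ 2 + dY (v t) q.1 q.2 ^ 2) (Ioc 0 L ×ˢ univ) :=
    integrableOn_strip_of_abs_le_exp ((((cux.pow 2).add ((cuy.sub cUB').pow 2)).add (cbx.pow 2)).add
      (cby.pow 2)) (by positivity : 0 ≤ 4 * (D * D)) hk' fun x _ y => by
        have h1 := pm (dn (hux x y)) (hux x y)
        have h2 := pm (dn (hay0 x y)) (hay0 x y)
        have h3 := pm (dn (hbx x y)) (hbx x y)
        have h4 := pm (dn (hby x y)) (hby x y)
        rw [abs_of_nonneg (by positivity), sq, sq, sq, sq]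
        linarith [le_abs_self (dX (u t) x y * dX (u t) x y),
          le_abs_self ((dY (u t) x y - UB' y) * (dY (u t) x y - UB' y)),
          le_abs_self (dX (v t) x y * dX (v t) x y), le_abs_self (dY (v t) x y * dY (v t) x y)]
  obtain ⟨iVa, iGa, hVa⟩ := stub_strainWorkIdentity_viscous L k' D (2 * D) a hL hk' ha2 hpera haD
    (fun x y => by linarith [hax x y, hay x y]) (fun x y => (hlapa x y).trans (by nlinarith [he0 y]))
  obtain ⟨iVb, iGb, hVb⟩ := stub_strainWorkIdentity_viscous L k' D (2 * D) (v t) hL hk' hv2 (h.periodic_v t ht')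
    hbD (fun x y => by linarith [hbx x y, hby x y]) (fun x y => (hlapb x y).trans (by nlinarith [he0 y]))
  -- the four identities: transport, pressure, viscosity
  have hTr : ∫ q in Ioc 0 L ×ˢ univ,
      (u t q.1 q.2 * dX φ q.1 q.2 + (v t q.1 q.2 - 1 * q.2) * dY φ q.1 q.2) =
      1 * ∫ q in Ioc 0 L ×ˢ univ, φ q.1 q.2 :=
    integral_strip_transport hL.le hu1 hv1 hφ1 (h.divFree t ht') (h.periodic_u t ht') hperφ iT1 iT2 iT3 iT4 iT5
  have hPr : ∫ q in Ioc 0 L ×ˢ univ, (a q.1 q.2 * dX (p t) q.1 q.2 + v t q.1 q.2 * dY (p t) q.1 q.2) = 0 :=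
    integral_strip_pressure_eq_zero hL.le ha1 hv1 hp1 hdiva hpera (h.periodic_p t ht') iP1 iP2 iP3 iP4 iP5
  have hφE : ∫ q in Ioc 0 L ×ˢ univ, φ q.1 q.2 =
      (1 / 2) * ∫ q in Ioc 0 L ×ˢ univ, (a q.1 q.2 ^ 2 + v t q.1 q.2 ^ 2) := by
    rw [← MeasureTheory.integral_const_mul]
    refine integral_congr_ae (Eventually.of_forall fun q => ?_)
    simp only [hφ_def]
    ring
  have hbb : ∫ q in Ioc 0 L ×ˢ univ, v t q.1 q.2 * v t q.1 q.2 = ∫ q in Ioc 0 L ×ˢ univ, v t q.1 q.2 ^ 2 :=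
    integral_congr_ae (Eventually.of_forall fun q => by simp only; ring)
  have hG : ∫ q in Ioc 0 L ×ˢ univ, (dX (u t) q.1 q.2 ^ 2 + (dY (u t) q.1 q.2 - UB' q.2) ^ 2 +
      dX (v t) q.1 q.2 ^ 2 + dY (v t) q.1 q.2 ^ 2) =
      (∫ q in Ioc 0 L ×ˢ univ, (dX a q.1 q.2 ^ 2 + dY a q.1 q.2 ^ 2)) +
        ∫ q in Ioc 0 L ×ˢ univ, (dX (v t) q.1 q.2 ^ 2 + dY (v t) q.1 q.2 ^ 2) := by
    rw [← integral_add iGa iGb]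
    refine integral_congr_ae (Eventually.of_forall fun q => ?_)
    simp only
    rw [hXa, hYa]
    ring
  -- pair the perturbation equations with `(a, b)`
  have hpt : ∀ q : ℝ × ℝ, a q.1 q.2 * deriv (fun s => u s q.1 q.2) t +
      v t q.1 q.2 * deriv (fun s => v s q.1 q.2) t =
      -(u t q.1 q.2 * dX φ q.1 q.2 + (v t q.1 q.2 - 1 * q.2) * dY φ q.1 q.2)
      - a q.1 q.2 * v t q.1 q.2 * UB' q.2
      + 1 * (v t q.1 q.2 * v t q.1 q.2)
      - (a q.1 q.2 * dX (p t) q.1 q.2 + v t q.1 q.2 * dY (p t) q.1 q.2)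
      + ν * (a q.1 q.2 * lap a q.1 q.2 + v t q.1 q.2 * lap (v t) q.1 q.2) := by
    intro q
    rw [hφx, hφy]
    have e1 := hmx q.1 q.2
    have e2 := hmy q.1 q.2
    rw [hXu, hYu, hLu] at e1
    linear_combination (a q.1 q.2) * e1 + (v t q.1 q.2) * e2 + (a q.1 q.2) * hode q.2
  have iT : IntegrableOn (fun q : ℝ × ℝ =>
      u t q.1 q.2 * dX φ q.1 q.2 + (v t q.1 q.2 - 1 * q.2) * dY φ q.1 q.2) (Ioc 0 L ×ˢ univ) := iT1.add iT3
  have iP : IntegrableOn (fun q : ℝ × ℝ =>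
      a q.1 q.2 * dX (p t) q.1 q.2 + v t q.1 q.2 * dY (p t) q.1 q.2) (Ioc 0 L ×ˢ univ) := iP1.add iP3
  have ivv : IntegrableOn (fun q : ℝ × ℝ => v t q.1 q.2 * v t q.1 q.2) (Ioc 0 L ×ˢ univ) :=
    ibb.congr_fun (fun q _ => by simp only; ring) (measurableSet_Ioc.prod MeasurableSet.univ)
  have i1 : IntegrableOn (fun q : ℝ × ℝ =>
      -(u t q.1 q.2 * dX φ q.1 q.2 + (v t q.1 q.2 - 1 * q.2) * dY φ q.1 q.2)) (Ioc 0 L ×ˢ univ) := iT.neg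
  have i2 : IntegrableOn (fun q : ℝ × ℝ =>
      -(u t q.1 q.2 * dX φ q.1 q.2 + (v t q.1 q.2 - 1 * q.2) * dY φ q.1 q.2)
      - a q.1 q.2 * v t q.1 q.2 * UB' q.2) (Ioc 0 L ×ˢ univ) := i1.sub iS
  have i3 : IntegrableOn (fun q : ℝ × ℝ =>
      -(u t q.1 q.2 * dX φ q.1 q.2 + (v t q.1 q.2 - 1 * q.2) * dY φ q.1 q.2)
      - a q.1 q.2 * v t q.1 q.2 * UB' q.2
      + 1 * (v t q.1 q.2 * v t q.1 q.2)) (Ioc 0 L ×ˢ univ) := i2.add (ivv.const_mul 1)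
  have i4 : IntegrableOn (fun q : ℝ × ℝ =>
      -(u t q.1 q.2 * dX φ q.1 q.2 + (v t q.1 q.2 - 1 * q.2) * dY φ q.1 q.2)
      - a q.1 q.2 * v t q.1 q.2 * UB' q.2
      + 1 * (v t q.1 q.2 * v t q.1 q.2)
      - (a q.1 q.2 * dX (p t) q.1 q.2 + v t q.1 q.2 * dY (p t) q.1 q.2)) (Ioc 0 L ×ˢ univ) := i3.sub iP
  have i5 : IntegrableOn (fun q : ℝ × ℝ =>
      ν * (a q.1 q.2 * lap a q.1 q.2 + v t q.1 q.2 * lap (v t) q.1 q.2)) (Ioc 0 L ×ˢ univ) :=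
    (iVa.add iVb).const_mul ν
  have hsplit : ∫ q in Ioc 0 L ×ˢ univ, (a q.1 q.2 * deriv (fun s => u s q.1 q.2) t +
      v t q.1 q.2 * deriv (fun s => v s q.1 q.2) t) =
      -(∫ q in Ioc 0 L ×ˢ univ, (u t q.1 q.2 * dX φ q.1 q.2 + (v t q.1 q.2 - 1 * q.2) * dY φ q.1 q.2))
      - (∫ q in Ioc 0 L ×ˢ univ, a q.1 q.2 * v t q.1 q.2 * UB' q.2)
      + 1 * (∫ q in Ioc 0 L ×ˢ univ, v t q.1 q.2 * v t q.1 q.2)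
      - (∫ q in Ioc 0 L ×ˢ univ, (a q.1 q.2 * dX (p t) q.1 q.2 + v t q.1 q.2 * dY (p t) q.1 q.2))
      + ν * ((∫ q in Ioc 0 L ×ˢ univ, a q.1 q.2 * lap a q.1 q.2) +
          ∫ q in Ioc 0 L ×ˢ univ, v t q.1 q.2 * lap (v t) q.1 q.2) := by
    rw [integral_congr_ae (Eventually.of_forall hpt), integral_add i4 i5, integral_sub i3 iP,
      integral_add i2 (ivv.const_mul 1), integral_sub i1 iS, MeasureTheory.integral_neg,
      MeasureTheory.integral_const_mul, MeasureTheory.integral_const_mul, integral_add iVa iVb]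
  refine ⟨iE, ibb, ibx, iS, iG, iL, ?_⟩
  rw [hsplit, hTr, hPr, hVa, hVb, hφE, hbb, hG]
  ring

end Summit.AnomalousDissipation.AnomalousDissipation.Theorems.StrainedLayerLaw.LogEnstrophyClock

end
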